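import Summits.Ventures.CertifiedManyBodySolver.Downfold.EmeryBoxesLa214ALLTrueCornerBandX015X022
import Summits.Ventures.CertifiedManyBodySolver.Downfold.EmeryBoxesLa214MixedOneBandImageX022
import Summits.Ventures.CertifiedManyBodySolver.Downfold.EmeryBoxesLa214OneBandImageX015
import Summits.Ventures.CertifiedManyBodySolver.Downfold.EmeryFermiScalePointsLa214Corners
import Summits.Ventures.CertifiedManyBodySolver.Downfold.EmeryOneBandImageBand
import Summits.Ventures.CertifiedManyBodySolver.Downfold.EmeryScaleBoxLa214X015Pts
import Summits.Ventures.CertifiedManyBodySolver.Downfold.EmeryScaleBoxLa214X022Pts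
import Summits.Ventures.CertifiedManyBodySolver.Downfold.EmeryVanHoveLa214
import HarnessLib

/-!
# THE ONE-BAND IMAGE OF BOX #18 OVER A DOPING BAND — `emeryBoxLa214v123 (whole Δ_pd hull [1.7, 4.0])`, x ∈ [0.15, 0.22] (ν ∈ [39/100, 17/40]; columns M16 … M17): ONE typed statement «∀ member θ ∀ filling ν ∈ [ν₁, ν₂]»
# (INFL-3to1-B §B.98 THE DOPING CONTINUUM; kernel `EmeryOneBandImageBand`; router/ONE-BAND-IMAGE-BANDS.tsv)

Venture CertifiedManyBodySolver, cell `pub/hubbard-downfold` (stage S1), seat hubbard-downfold-mod-4 (technique B, g43); namespace `Summit.Ventures.CertifiedManyBodySolver.Downfold.Emery`.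
Everything PROVED (0 sorry; no new certificate). DEVICE: at fixed θ every image coordinate is monotone in the Fermi energy (t_node ↓, w_node ↓, w_face ↓, w_axis ↓ in ε; corpus levers) and
ε_F(θ; ν) is non-decreasing in ν, so each coordinate at ν ∈ [ν₁, ν₂] lies between its values at the END fillings, which the landed column capstones `la214Box_oneBandImage_x015` (x = 0.15) and `la214Box_oneBandImage_x022` (x = 0.22) window for
every member; the box-wide Fermi-energy ceiling E_h = 487/200 (`cornerPt_la214BoxHi_x0_br` at half filling) carries the regime margins; t′/t by the true-corner band device `EmeryBoxesLa214ALLTrueCornerBandX015X022`.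
WHAT THIS IS NOT: a statement about La₂₋ₓSrₓCuO₄ — the typed box and its Δ_pd level tags are SCREENING-GRADE; `U = 0` one-body kinematics of the σ model (rigid band); no U number; not a phase word.

| box | doping band | t (eV) | t′/t | w_node | 4th / 5th coordinate |
|---|---|---|---|---|---|
| emeryBoxLa214v123 (whole Δ_pd hull [1.7, 4.0]) | x ∈ [0.15, 0.22] (ν ∈ [39/100, 17/40]; columns M16 … M17) | [0.3371, 0.6635] | [-0.2933, -0.1681] | [0.5639, 0.8099] | every Fermi-surface Bloch state's Cu-d weight `≤ 0.8359` (universal axis-corner ceiling; the band straddles or touches the box's van Hove window, so no uniform topology) |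

Sources: three-band model [HybertsenSchluterChristensen1989, Eq. (1)]; [AndersenEtAl1995, §6]; [folklore] algebra.
-/

noncomputable section

namespace Summit.Ventures.CertifiedManyBodySolver.Downfold.Emery

open Real Set

/-- **THE ONE-BAND IMAGE OF `emeryBoxLa214v123` — emeryBoxLa214v123 (whole Δ_pd hull [1.7, 4.0]) — OVER THE DOPING BAND x ∈ [0.15, 0.22] (ν ∈ [39/100, 17/40]; columns M16 … M17)**: for EVERY member θ AND EVERY filling ν of the band: `t ∈ [0.3371, 0.6635]` eV, `t′/t ∈ [-0.2933, -0.1681]`, `w_node ∈ [0.5639, 0.8099]`, every Fermi-surface Bloch state's Cu-d weight `≤ 0.8359` (universal axis-corner ceiling; the band straddles or touches the box's van Hove window, so no uniform topology). Pure composition: kernel `EmeryOneBandImageBand` (filling levers) + the two END-column capstones `la214Box_oneBandImage_x015` / `la214Box_oneBandImage_x022` + the t′/t true-corner band `la214ALLBox_fsRatio_true_band_x015_x022`. [folklore] -/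
theorem la214Box_oneBandImage_band_x015_x022 {Δ a b c ν : ℝ} (hΔ : Δ ∈ Icc ((17 : ℝ) / 10) (4 : ℝ)) (ha : a ∈ Icc ((129 : ℝ) / 100) ((38 : ℝ) / 25)) (hb : b ∈ Icc ((23 : ℝ) / 50) ((33 : ℝ) / 50)) (hc : c ∈ Icc ((3 : ℝ) / 25) ((3 : ℝ) / 20)) (hν : ν ∈ Icc ((39 : ℝ) / 100) ((17 : ℝ) / 40)) :
    scaleT Δ a b c (xNode Δ a b c (fermiEnergyOf Δ a b c ν)) (xNode Δ a b c (fermiEnergyOf Δ a b c ν)) (fermiEnergyOf Δ a b c ν) ∈ Icc (3371/10000 : ℝ) (6635/10000 : ℝ) ∧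
      fsRatio Δ a b c (fermiEnergyOf Δ a b c ν) ∈ Icc ((-2933 : ℝ) / 10000) ((-1681 : ℝ) / 10000) ∧
      dWeightNode Δ a b c (fermiEnergyOf Δ a b c ν) ∈ Icc ((5639 : ℝ) / 10000) ((8099 : ℝ) / 10000) ∧
      (∀ x y : ℝ, x ∈ Icc (0 : ℝ) 1 → y ∈ Icc (0 : ℝ) 1 → charCubic Δ a b c x y (fermiEnergyOf Δ a b c ν) = 0 →
        dWeight Δ a b c x y (fermiEnergyOf Δ a b c ν) ≤ ((8359 : ℝ) / 10000)) := by
  have hΔ0 : 0 < Δ := lt_of_lt_of_le (by norm_num) hΔ.1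
  have ha0 : 0 < a := lt_of_lt_of_le (by norm_num) ha.1
  have hc0 : 0 ≤ c := le_trans (by norm_num) hc.1
  have hcb : c ≤ b := hc.2.trans (le_trans (by norm_num) hb.1)
  have hb0 : 0 ≤ b := hc0.trans hcb
  have hΔw : Δ ∈ Icc ((17 : ℝ) / 10) (4 : ℝ) := ⟨le_trans (by norm_num) hΔ.1, le_trans hΔ.2 (by norm_num)⟩
  -- the two END columns (landed capstones)
  have h2 := la214Box_oneBandImage_x015 hΔ ha hb hc
  have h1 := la214Box_oneBandImage_x022 hΔ ha hb hc
  -- the box-wide Fermi-energy ceiling E_h = 487/200 (corner (1.7, 1.52, 0.66, 0.12) at half filling) serves every band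
  have hT := (fermiEnergyOf_of_pointBracketCheck cornerPt_la214BoxHi_x0_br (by norm_num) (by norm_num) (by norm_num) (ν := (1/2 : ℝ)) (by push_cast; exact ⟨le_rfl, le_rfl⟩)).2
  push_cast at hT
  have hbox := fermiEnergyOf_mem_Icc_of_mem_box' (ν := ((1 : ℝ) / 2)) (by norm_num) (by norm_num) (by norm_num) (by norm_num) hΔw ha hb hc (by norm_num) (by norm_num)
  have hhalf : ((1 : ℝ) / 2) = (1/2 : ℝ) := by norm_num
  have hEh0 : fermiEnergyOf Δ a b c ((1 : ℝ) / 2) ≤ ((487 : ℝ) / 200) := by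
    refine hbox.2.trans ?_
    rw [hhalf]; exact hT.2
  have hEh : fermiEnergyOf Δ a b c ((17 : ℝ) / 40) ≤ ((487 : ℝ) / 200) :=
    fermiEnergyOf_le_of_band (ν₂ := ((1 : ℝ) / 2)) hΔ0 ha0.ne' hc0 hb0 (by norm_num) (by norm_num) (by norm_num) hEh0
  have ha2 : ((129 : ℝ) / 100) ^ 2 ≤ a ^ 2 := pow_le_pow_left₀ (by norm_num) ha.1 2
  have hm : c * (((487 : ℝ) / 200)) < a ^ 2 := by nlinarith [hc.2]
  have hq : b * Δ < 4 * a ^ 2 := by nlinarith [mul_le_mul hb.2 hΔw.2 hΔ0.le (by norm_num : (0 : ℝ) ≤ (33 : ℝ) / 50)]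
  -- the universal axis-corner ceiling over the band: E_l from the x022 floor bracket at ν₁, E_h from the x015 top bracket at ν₂
  have hF := (fermiEnergyOf_of_pointBracketCheck scalePt_La214X022_FL_br (by norm_num) (by norm_num) (by norm_num) (ν := (39/100 : ℝ)) (by push_cast; exact ⟨le_rfl, le_rfl⟩)).2
  have hT' := (fermiEnergyOf_of_pointBracketCheck scalePt_La214X015_TP_br (by norm_num) (by norm_num) (by norm_num) (ν := (17/40 : ℝ)) (by push_cast; exact ⟨le_rfl, le_rfl⟩)).2
  push_cast at hF hT'
  refine ⟨?_, la214ALLBox_fsRatio_true_band_x015_x022 hΔ ha hb hc hν, ?_, fun x y hx hy hP => ?_⟩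
  · exact scaleT_node_fermiEnergyOf_mem_Icc_of_band hΔ0 ha0.ne' hc0 hcb (by norm_num) hν (by norm_num) hEh hm hq h2.1.1 h1.1.2
  · exact dWeightNode_fermiEnergyOf_mem_Icc_of_band hΔ0 ha0.ne' hc0 hcb (by norm_num) hν (by norm_num) h2.2.2.1.1 h1.2.2.1.2
  · exact dWeight_le_of_mem_box_axis'_band (El := ((559 : ℝ) / 500)) (Eh := ((22317 : ℝ) / 10000)) (by norm_num) (by norm_num) (by norm_num) (by norm_num) (by norm_num) hΔ ha hb hc (by norm_num) hν (by norm_num)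
      (by norm_num) hF.1 hT'.2 (by norm_num) (by norm_num) (by norm_num) (by norm_num [dWeightAxisCF]) hx hy hP

end Summit.Ventures.CertifiedManyBodySolver.Downfold.Emery
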